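import Summits.BirchSwinnertonDyer.BirchSwinnertonDyer.Theorems.SylvesterTwoHeegnerIndexCoupledDescentCebotarevSylvesterPair
import HarnessLib

/-!
# (hL3b) at `p = 2` for the Sylvester pair: hypothesis (C4) reduced to the bottom POINT

Leaf (L3b) of VARIANT K (crux `UpperOffV0HSYPlus`, stmt-BirchSwinnertonDyer-19804) at `p = 2`
(`SylvesterTwoCoupledDescentCebotarev.exists_cmH1_infinite_kolyvaginPrimes_line_sylvesterPair`)
displays the datum (C4): a generator `x₁` of the `𝔽₄`-line of the bottom class `y` FIXED by
the conjugation `c_*` of `H¹(K, B_K[2])`. For the bottom class of the (L3) assembly,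
`y = δY` the Kummer class of a point `Y ∈ B(K)`, one may take `x₁ := δY` as soon as
`c_* δY = δY`; and since `c_* δ = δ ∘ c` (tree `conjAct_kummerMapTorsion`) and
`2 · H¹(K, B_K[2]) = 0`, this holds whenever `c Y = ε Y + 2R` with `ε` odd — in particular
whenever `c Y + ε Y` is torsion with `ε` odd and `B(K)` has no `2`-power torsion (the shape of
the tree's reflection law `heegnerPoint_conj_add_rootNumber_smul_holds`, Gross 1991 Prop. 5.3 /
Darmon Prop. 3.11: `σ y_K + w_E · y_K` has finite order; and `E_p(ℚ(ω))[2^∞] = 0` by k-ty1's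
`cubeSumCurve_eq_zero_of_two_pow_smul_eq_zero` + `pow_three_ne_two_mul_sq`).
This file proves the generic level-`2` glue (`two_zsmul_galH1Torsion_two`,
`odd_zsmul_galH1Torsion_two`, `conjAct_kummerClassOfPoint_two_eq_self`,
`…_of_isOfFinAddOrder`), `E_p(K)[2^∞] = 0` (`cubeSumCurve_prime_eq_zero_of_two_pow_smul_eq_zero`)
and the (C4)-free form of (hL3b) at the Sylvester pair
(`exists_cmH1_infinite_kolyvaginPrimes_line_sylvesterPair_of_point`), whose only displayed
inputs are the bottom point `Y ∈ E_p(K)` with «`c Y + ε Y` torsion, `ε` odd», and the levels.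
Theorem-only; nothing asserted on 19804; no label moves; BSD not claimed for any curve.
-/

set_option linter.dupNamespace false -- Summits modules are `Summit.<Summit>.<Problem>…` by design

noncomputable section

open scoped Classical
open WeierstrassCurve NumberField IsDedekindDomain Field
open Literature.NumberTheory.EllipticCurves Literature.NumberTheory.GaloisRepresentations
open Literature.NumberTheory.EllipticCurves.HuShuYin2019

namespace Summit.BirchSwinnertonDyer.BirchSwinnertonDyer.Theorems.SylvesterTwoCoupledDescentCebotarev

variable {K : Type} [Field K] [NumberField K]

section Glue

variable (W : WeierstrassCurve ℚ) (σ : K ≃ₐ[ℚ] K) (P : (W.baseChange K).toAffine.Point)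

/-- `2 · H¹(K, W_K[2]) = 0` (the level as the literal `2 : ℤ`). [folklore] -/
theorem two_zsmul_galH1Torsion_two (x : galH1Torsion (W.baseChange K) ((2 : ℕ) : ℤ)) :
    (2 : ℤ) • x = 0 := by
  have h := zsmul_galH1Torsion_eq_zero (W.baseChange K) ((2 : ℕ) : ℤ) x
  simpa using h

/-- An odd integer acts as the identity on `H¹(K, W_K[2])` (`2 · H¹ = 0`). [folklore] -/
theorem odd_zsmul_galH1Torsion_two {ε : ℤ} (hε : Odd ε)
    (x : galH1Torsion (W.baseChange K) ((2 : ℕ) : ℤ)) : ε • x = x := by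
  obtain ⟨k, rfl⟩ := hε
  rw [add_zsmul, one_zsmul, mul_comm, mul_zsmul, two_zsmul_galH1Torsion_two W, zsmul_zero,
    zero_add]

/-- **`c_* δP = δP` at level `2` from `c P = ε P + 2R`, `ε` odd.** The Kummer map commutes with
`σ ∈ Aut(K/ℚ)` (`conjAct_kummerMapTorsion`), is additive, and `2 · H¹(K, W_K[2]) = 0`.
[folklore] -/
theorem conjAct_kummerClassOfPoint_two_eq_self
    (h : ∃ ε : ℤ, Odd ε ∧ ∃ R : (W.baseChange K).toAffine.Point,
      Affine.Point.map (W' := W) (σ : K →ₐ[ℚ] K) P = ε • P + (2 : ℤ) • R) :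
    conjAct W σ ((2 : ℕ) : ℤ) (kummerClassOfPoint W K Nat.prime_two P) =
      kummerClassOfPoint W K Nat.prime_two P := by
  obtain ⟨ε, hε, R, hR⟩ := h
  unfold kummerClassOfPoint
  rw [conjAct_kummerMapTorsion, hR, map_add, map_zsmul, map_zsmul,
    odd_zsmul_galH1Torsion_two W hε, two_zsmul_galH1Torsion_two W, add_zero]

/-- **`c_* δP = δP` at level `2` from «`c P + ε P` torsion, `ε` odd» when `W(K)` has no `2`-power
torsion** — the shape of the tree's reflection law `heegnerPoint_conj_add_rootNumber_smul_holds`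
(`σ P + w_E • P` has finite order, `w_E = ±1`). With `T := σ P + ε P` of order `2ᵏ·m'`, `m'` odd:
`m' • T` is killed by `2ᵏ`, hence vanishes, so `T = 2R` with `R := (m'+1)/2 • T`, and
`conjAct_kummerClassOfPoint_two_eq_self` applies with `-ε`. [folklore] -/
theorem conjAct_kummerClassOfPoint_two_eq_self_of_isOfFinAddOrder
    (h2t : ∀ (k : ℕ) (Q : (W.baseChange K).toAffine.Point), 2 ^ k • Q = 0 → Q = 0)
    (h : ∃ ε : ℤ, Odd ε ∧
      IsOfFinAddOrder (Affine.Point.map (W' := W) (σ : K →ₐ[ℚ] K) P + ε • P)) :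
    conjAct W σ ((2 : ℕ) : ℤ) (kummerClassOfPoint W K Nat.prime_two P) =
      kummerClassOfPoint W K Nat.prime_two P := by
  obtain ⟨ε, hε, hfin⟩ := h
  set T := Affine.Point.map (W' := W) (σ : K →ₐ[ℚ] K) P + ε • P with hT
  obtain ⟨k, m', hm', hm⟩ := Nat.exists_eq_two_pow_mul_odd hfin.addOrderOf_pos.ne'
  have hm'T : m' • T = 0 := by
    refine h2t k (m' • T) ?_
    rw [← mul_nsmul', ← hm]
    exact addOrderOf_nsmul_eq_zero T
  obtain ⟨h', hh'⟩ := hm'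
  refine conjAct_kummerClassOfPoint_two_eq_self W σ P ⟨-ε, hε.neg, (h' + 1) • T, ?_⟩
  have h2R : (2 : ℤ) • (h' + 1) • T = T := by
    rw [show (2 : ℤ) • (h' + 1) • T = (2 * (h' + 1)) • T by rw [mul_nsmul', ← natCast_zsmul]; rfl,
      show 2 * (h' + 1) = m' + 1 by omega, add_nsmul, hm'T, one_nsmul, zero_add]
  rw [h2R, hT, neg_zsmul]
  abel

end Glue

section SylvesterPair

variable {ω : K} (hω : ω ^ 2 + ω + 1 = 0) (h2 : Module.finrank ℚ K = 2) {p : ℕ} (hp : p.Prime)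
include hω h2 hp

/-- **`E_p(K)` has no `2`-power torsion** (`K = ℚ(ω)`, `p` an odd prime): a point of order `2` on
`y² = x³ − 432p²` is `(6∛(2p²), 0)` and `∛(2p²) ∉ ℚ(ω)` — k-ty1's
`cubeSumCurve_eq_zero_of_two_pow_smul_eq_zero` with `pow_three_ne_two_mul_sq`. -/
theorem cubeSumCurve_prime_eq_zero_of_two_pow_smul_eq_zero (hp2 : p ≠ 2) (k : ℕ)
    (Q : ((cubeSumCurve (p : ℚ)).baseChange K).toAffine.Point) (hQ : 2 ^ k • Q = 0) : Q = 0 := by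
  have hK := JZero.isImaginaryQuadratic_of_sq_add_self_add_one hω h2
  have hdK := JZero.odd_discr_of_sq_add_self_add_one hω h2
  refine cubeSumCurve_eq_zero_of_two_pow_smul_eq_zero (p : ℚ) (fun t ht ↦ ?_) k Q hQ
  refine pow_three_ne_two_mul_sq hK hdK (n := (p : ℤ)) (by exact_mod_cast hp.odd_of_ne_two hp2) t ?_
  rw [ht]
  push_cast
  ring

end SylvesterPair

/-- **(hL3b) at `p = 2` for the Sylvester pair `(A, B) = (E_{3p²}, E_p)`, (C4) reduced to the
bottom point.** For `Y ∈ E_p(K)` with `c Y + ε Y` of finite order for some odd `ε` (the tree's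
reflection law `heegnerPoint_conj_add_rootNumber_smul_holds` gives this for a Heegner point of the
minimal model, `ε = w_E = ±1`) and `δY ∈ H¹(K, E_p[2])` its Kummer class: there are
`[ω]`-data `φB / fnB / hfnB` on `E_p ⁄ K`
(characterised as in `exists_cmH1_infinite_kolyvaginPrimes_line_sylvesterPair`) such that for
every `s` off the `𝔽₄`-line of `δY` and every `cl ≠ 0` in `H¹(K, E_{3p²}[2])`: infinitely many
Kolyvagin primes `ℓ` with `(δY)_λ = 0`, `s_λ ≠ 0`, `cl_λ ≠ 0`. (`x₁ := y := δY` in the package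
form; `c_* δY = δY` by `conjAct_kummerClassOfPoint_two_eq_self_of_isOfFinAddOrder` and
`cubeSumCurve_prime_eq_zero_of_two_pow_smul_eq_zero`.) -/
theorem exists_cmH1_infinite_kolyvaginPrimes_line_sylvesterPair_of_point {ω : K}
    (hω : ω ^ 2 + ω + 1 = 0) (h2 : Module.finrank ℚ K = 2) {p : ℕ} (hp : p.Prime)
    (hp3 : p % 3 = 1) {c : K ≃ₐ[ℚ] K} (hcω : c ω = ω ^ 2) {NA NB : ℕ} [NeZero NA] [NeZero NB]
    (Y : ((cubeSumCurve (p : ℚ)).baseChange K).toAffine.Point)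
    (hY : ∃ ε : ℤ, Odd ε ∧
      IsOfFinAddOrder (Affine.Point.map (W' := cubeSumCurve (p : ℚ)) (c : K →ₐ[ℚ] K) Y + ε • Y)) :
    ∃ (φB : geomPoints ((cubeSumCurve (p : ℚ)).baseChange K) →+
        geomPoints ((cubeSumCurve (p : ℚ)).baseChange K))
      (fnB : geomTorsion ((cubeSumCurve (p : ℚ)).baseChange K) ((2 : ℕ) : ℤ) →+
        geomTorsion ((cubeSumCurve (p : ℚ)).baseChange K) ((2 : ℕ) : ℤ))
      (hfnB : ∀ (σ : absoluteGaloisGroup K)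
        (P : geomTorsion ((cubeSumCurve (p : ℚ)).baseChange K) ((2 : ℕ) : ℤ)),
        fnB (ContinuousMonoidHom.id _ σ • P) = σ • fnB P),
      (∀ P, φB (φB P) + φB P + P = 0) ∧
      (∀ (x y : AlgebraicClosure K)
        (h : (((cubeSumCurve (p : ℚ)).baseChange K).baseChange
          (AlgebraicClosure K)).toAffine.Nonsingular x y),
        ∃ h', φB (Affine.Point.some x y h) =
          Affine.Point.some (algebraMap K (AlgebraicClosure K) ω ^ 2 * x) y h') ∧
      (∀ P : geomTorsion ((cubeSumCurve (p : ℚ)).baseChange K) ((2 : ℕ) : ℤ),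
        ((fnB P : geomTorsion ((cubeSumCurve (p : ℚ)).baseChange K) ((2 : ℕ) : ℤ)) :
          geomPoints ((cubeSumCurve (p : ℚ)).baseChange K)) = φB P) ∧
      ∀ s : galH1Torsion ((cubeSumCurve (p : ℚ)).baseChange K) ((2 : ℕ) : ℤ),
        (¬ ∃ a b : ℤ, s = a • kummerClassOfPoint (cubeSumCurve (p : ℚ)) K Nat.prime_two Y +
          b • resH1Hom (ContinuousMonoidHom.id _) fnB hfnB
            (kummerClassOfPoint (cubeSumCurve (p : ℚ)) K Nat.prime_two Y)) →
        ∀ cl : galH1Torsion ((cubeSumCurve (3 * (p : ℚ) ^ 2)).baseChange K) ((2 : ℕ) : ℤ),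
          cl ≠ 0 →
          Set.Infinite {ℓ : ℕ | (ℓ.Prime ∧ ¬ ℓ ∣ NA ∧ ¬ ℓ ∣ NB ∧
              ¬ ((ℓ : ℤ) ∣ NumberField.discr K) ∧ ℓ ≠ 2 ∧ (Ideal.span {(ℓ : 𝓞 K)}).IsPrime ∧
              FrobEqFrobInfty (cubeSumCurve (3 * (p : ℚ) ^ 2)) K 2 ℓ ∧
              FrobEqFrobInfty (cubeSumCurve (p : ℚ)) K 2 ℓ) ∧
            ∀ v : HeightOneSpectrum (𝓞 K), (ℓ : 𝓞 K) ∈ v.asIdeal →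
              kummerClassOfPoint (cubeSumCurve (p : ℚ)) K Nat.prime_two Y ∈
                ((cubeSumCurve (p : ℚ)).baseChange K).torsionLocalKer
                  (v.adicCompletion K) ((2 : ℕ) : ℤ) ∧
              s ∉ ((cubeSumCurve (p : ℚ)).baseChange K).torsionLocalKer
                (v.adicCompletion K) ((2 : ℕ) : ℤ) ∧
              cl ∉ ((cubeSumCurve (3 * (p : ℚ) ^ 2)).baseChange K).torsionLocalKer
                (v.adicCompletion K) ((2 : ℕ) : ℤ)} := by
  obtain ⟨φB, fnB, hfnB, hφBrel, hφB, hcoeB, h⟩ :=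
    exists_cmH1_infinite_kolyvaginPrimes_line_sylvesterPair (NA := NA) (NB := NB) hω h2 hp hp3 hcω
  refine ⟨φB, fnB, hfnB, hφBrel, hφB, hcoeB, fun s hs cl hcl ↦ ?_⟩
  have hp2 : p ≠ 2 := by rintro rfl; norm_num at hp3
  exact h _ _ (conjAct_kummerClassOfPoint_two_eq_self_of_isOfFinAddOrder _ c Y
      (cubeSumCurve_prime_eq_zero_of_two_pow_smul_eq_zero hω h2 hp hp2) hY)
    ⟨1, 0, by rw [one_zsmul, zero_zsmul, add_zero]⟩ (fun a b ↦ ⟨a, b, rfl⟩) s hs cl hcl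

/-- **(hL3b) at `p = 2` for the Sylvester pair, (C4) reduced to the bottom point — split form**
(planner D426 (s3)): the eigen-relation as «`c Y = ε Y + T`, `ε` odd, `T` of finite order»
(Gross 1991 Prop. 5.3: `y_K^c ≡ −ε y_K` modulo `E(K)_tors`); reduced to
`exists_cmH1_infinite_kolyvaginPrimes_line_sylvesterPair_of_point` with `-ε`. -/
theorem exists_cmH1_infinite_kolyvaginPrimes_line_sylvesterPair_of_point' {ω : K}
    (hω : ω ^ 2 + ω + 1 = 0) (h2 : Module.finrank ℚ K = 2) {p : ℕ} (hp : p.Prime)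
    (hp3 : p % 3 = 1) {c : K ≃ₐ[ℚ] K} (hcω : c ω = ω ^ 2) {NA NB : ℕ} [NeZero NA] [NeZero NB]
    (Y : ((cubeSumCurve (p : ℚ)).baseChange K).toAffine.Point)
    (hY : ∃ ε : ℤ, Odd ε ∧ ∃ T : ((cubeSumCurve (p : ℚ)).baseChange K).toAffine.Point,
      IsOfFinAddOrder T ∧
        Affine.Point.map (W' := cubeSumCurve (p : ℚ)) (c : K →ₐ[ℚ] K) Y = ε • Y + T) :
    ∃ (φB : geomPoints ((cubeSumCurve (p : ℚ)).baseChange K) →+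
        geomPoints ((cubeSumCurve (p : ℚ)).baseChange K))
      (fnB : geomTorsion ((cubeSumCurve (p : ℚ)).baseChange K) ((2 : ℕ) : ℤ) →+
        geomTorsion ((cubeSumCurve (p : ℚ)).baseChange K) ((2 : ℕ) : ℤ))
      (hfnB : ∀ (σ : absoluteGaloisGroup K)
        (P : geomTorsion ((cubeSumCurve (p : ℚ)).baseChange K) ((2 : ℕ) : ℤ)),
        fnB (ContinuousMonoidHom.id _ σ • P) = σ • fnB P),
      (∀ P, φB (φB P) + φB P + P = 0) ∧
      (∀ (x y : AlgebraicClosure K)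
        (h : (((cubeSumCurve (p : ℚ)).baseChange K).baseChange
          (AlgebraicClosure K)).toAffine.Nonsingular x y),
        ∃ h', φB (Affine.Point.some x y h) =
          Affine.Point.some (algebraMap K (AlgebraicClosure K) ω ^ 2 * x) y h') ∧
      (∀ P : geomTorsion ((cubeSumCurve (p : ℚ)).baseChange K) ((2 : ℕ) : ℤ),
        ((fnB P : geomTorsion ((cubeSumCurve (p : ℚ)).baseChange K) ((2 : ℕ) : ℤ)) :
          geomPoints ((cubeSumCurve (p : ℚ)).baseChange K)) = φB P) ∧
      ∀ s : galH1Torsion ((cubeSumCurve (p : ℚ)).baseChange K) ((2 : ℕ) : ℤ),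
        (¬ ∃ a b : ℤ, s = a • kummerClassOfPoint (cubeSumCurve (p : ℚ)) K Nat.prime_two Y +
          b • resH1Hom (ContinuousMonoidHom.id _) fnB hfnB
            (kummerClassOfPoint (cubeSumCurve (p : ℚ)) K Nat.prime_two Y)) →
        ∀ cl : galH1Torsion ((cubeSumCurve (3 * (p : ℚ) ^ 2)).baseChange K) ((2 : ℕ) : ℤ),
          cl ≠ 0 →
          Set.Infinite {ℓ : ℕ | (ℓ.Prime ∧ ¬ ℓ ∣ NA ∧ ¬ ℓ ∣ NB ∧
              ¬ ((ℓ : ℤ) ∣ NumberField.discr K) ∧ ℓ ≠ 2 ∧ (Ideal.span {(ℓ : 𝓞 K)}).IsPrime ∧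
              FrobEqFrobInfty (cubeSumCurve (3 * (p : ℚ) ^ 2)) K 2 ℓ ∧
              FrobEqFrobInfty (cubeSumCurve (p : ℚ)) K 2 ℓ) ∧
            ∀ v : HeightOneSpectrum (𝓞 K), (ℓ : 𝓞 K) ∈ v.asIdeal →
              kummerClassOfPoint (cubeSumCurve (p : ℚ)) K Nat.prime_two Y ∈
                ((cubeSumCurve (p : ℚ)).baseChange K).torsionLocalKer
                  (v.adicCompletion K) ((2 : ℕ) : ℤ) ∧
              s ∉ ((cubeSumCurve (p : ℚ)).baseChange K).torsionLocalKer
                (v.adicCompletion K) ((2 : ℕ) : ℤ) ∧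
              cl ∉ ((cubeSumCurve (3 * (p : ℚ) ^ 2)).baseChange K).torsionLocalKer
                (v.adicCompletion K) ((2 : ℕ) : ℤ)} :=
  exists_cmH1_infinite_kolyvaginPrimes_line_sylvesterPair_of_point hω h2 hp hp3 hcω Y <| by
    obtain ⟨ε, hε, T, hT, hYT⟩ := hY
    refine ⟨-ε, hε.neg, ?_⟩
    rwa [hYT, neg_zsmul, add_neg_cancel_comm]

end Summit.BirchSwinnertonDyer.BirchSwinnertonDyer.Theorems.SylvesterTwoCoupledDescentCebotarev

end
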